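import Summits.ValiantsHypothesis.ValiantsHypothesis.Theorems.LacunarySymmetroidMatrixDescartesDoorA26WallBubblingMixGram

/-!
# Wall bubbling for `DoorA26` — WEYL QUINTUPLES: the ordered value classes at the stratum [5,1] (level-`ν` bookkeeping)

HONEST FRAMING.  Chain lemmas toward `TripleStratum26` of `Cruxes/DoorA26/Lines/wall_bubbling_ConfluentDoor.lean` (rev 13; crux `DoorA26`,
stmt-ValiantsHypothesis-19979 — OPEN, typed, never asserted), pattern [5,1] in normal position (quintuple at `1,2,3,4,5`, single letter `0`).
W1 seat val-sym-door-p2 g15 (#102); the [5,1] twin of #95 `…WeylQuadClasses`.  ALGEBRA ONLY (def-free).  Value index `v = ![0,1,1,1,1,1] : Fin 6 → Fin 2`,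
value positions `a ↦ a.castSucc⁴` (`0 ↦ 0`, `1 ↦ 1`), classes `Fin 2 × Fin 2` (ordered), deviations `η_l = δ_l − δ_{v l}` (zero at `0, 1`):

* `weylQuint_det_eq_memberSum` — `det Σ_l e^{δ_l t}U_l` as the 36-member sum with exponents split `(δ_{v p}+δ_{v q}) + (η_p+η_q)`;
* `weylQuint_fib`, `weylQuint_v_cast`, `sum_class_eq₅`, `weylQuint_eta_cast` — fibres and class sums;
* `classMoment_quint` (class `(1,1)` = the `Fin 5` frame moments of `V = U ∘ ![1,2,3,4,5]`), `classMoment_mixed_left₅/right₅` (a single letter against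
  the frame letter `T_m = Σ_q x_q^m V_q`), `classMoment_pure₅` (one member), `classMoment_swap₅`;
* `quintMoment_symmetrise` — the 25 ordered members have the moments of the FIFTEEN weighted members `p ≤ q` (member count for #81 `momentTail`).

Nothing here bears on `DoorA26`, `MatrixDescartes` (stmt-ValiantsHypothesis-18050) or `VP ≠ VNP`; `TripleStratum26`, (W), (M) OPEN.
`--supports stmt-ValiantsHypothesis-19979 --as helper`.  [this work].
-/

-- `Summit.ValiantsHypothesis.ValiantsHypothesis.…` repeats a component by the D-0017 layout
-- (single-conjunct summit), which the `dupNamespace` linter flags; the name is mandated.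
set_option linter.dupNamespace false

namespace Summit.ValiantsHypothesis.ValiantsHypothesis.Theorems.LacunarySymmetroidMatrixDescartes.WallBubbling

open Finset
open Bubbling (polar polar_apply det_sum_smul_fin_two)
open scoped BigOperators

/-! ## 1. The determinant as the member sum -/

/-- **The determinant as the ordered member sum** (pattern [5,1]), exponents split as class centre plus deviation. [this work] -/
theorem weylQuint_det_eq_memberSum (δ : Fin 6 → ℝ) (U : Fin 6 → Matrix (Fin 2) (Fin 2) ℝ) (t : ℝ) :
    (∑ l, Real.exp (δ l * t) • U l).det
      = ∑ i : Fin 6 × Fin 6, polar (U i.1) (U i.2) *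
          Real.exp (((δ (((![0, 1, 1, 1, 1, 1] : Fin 6 → Fin 2) i.1).castSucc.castSucc.castSucc.castSucc)
              + δ (((![0, 1, 1, 1, 1, 1] : Fin 6 → Fin 2) i.2).castSucc.castSucc.castSucc.castSucc))
            + ((δ i.1 - δ (((![0, 1, 1, 1, 1, 1] : Fin 6 → Fin 2) i.1).castSucc.castSucc.castSucc.castSucc))
              + (δ i.2 - δ (((![0, 1, 1, 1, 1, 1] : Fin 6 → Fin 2) i.2).castSucc.castSucc.castSucc.castSucc)))) * t) := by
  rw [det_sum_smul_fin_two, Fintype.sum_prod_type]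
  refine Finset.sum_congr rfl fun p _ => Finset.sum_congr rfl fun q _ => ?_
  rw [← Real.exp_add]
  ring_nf

/-! ## 2. Fibres of the value index and class sums -/

/-- The fibres of the value index `v = ![0,1,1,1,1,1]`. [this work] -/
theorem weylQuint_fib (a : Fin 2) :
    (univ.filter fun p : Fin 6 => (![0, 1, 1, 1, 1, 1] : Fin 6 → Fin 2) p = a)
      = if a = 1 then {1, 2, 3, 4, 5} else {a.castSucc.castSucc.castSucc.castSucc} := by
  fin_cases a <;> decide

/-- The value index of a value position is the value. [this work] -/
theorem weylQuint_v_cast (a : Fin 2) : (![0, 1, 1, 1, 1, 1] : Fin 6 → Fin 2) a.castSucc.castSucc.castSucc.castSucc = a := by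
  fin_cases a <;> rfl

/-- A class sum over the ordered members is a double sum over the two fibres. [this work] -/
theorem sum_class_eq₅ (f : Fin 6 → Fin 6 → ℝ) (α β : Fin 2) :
    ∑ i : Fin 6 × Fin 6, (if ((![0, 1, 1, 1, 1, 1] : Fin 6 → Fin 2) i.1, (![0, 1, 1, 1, 1, 1] : Fin 6 → Fin 2) i.2) = (α, β)
        then f i.1 i.2 else 0)
      = ∑ p ∈ univ.filter (fun p : Fin 6 => (![0, 1, 1, 1, 1, 1] : Fin 6 → Fin 2) p = α),
          ∑ q ∈ univ.filter (fun q : Fin 6 => (![0, 1, 1, 1, 1, 1] : Fin 6 → Fin 2) q = β), f p q := by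
  rw [Fintype.sum_prod_type, Finset.sum_filter]
  refine Finset.sum_congr rfl fun p _ => ?_
  rw [Finset.sum_filter]
  by_cases hp : (![0, 1, 1, 1, 1, 1] : Fin 6 → Fin 2) p = α
  · rw [if_pos hp]
    refine Finset.sum_congr rfl fun q _ => ?_
    simp only [Prod.mk.injEq, hp, true_and]
  · rw [if_neg hp]
    refine Finset.sum_eq_zero fun q _ => ?_
    simp only [Prod.mk.injEq, hp, false_and, if_false]

/-! ## 3. The class moments in frame language -/

/-- **Class `(1,1)` (the quintuple's own class)**: its moments are the `Fin 5` frame moments with `V = U ∘ ![1,2,3,4,5]`. [this work] -/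
theorem classMoment_quint (U : Fin 6 → Matrix (Fin 2) (Fin 2) ℝ) (η : Fin 6 → ℝ) (m : ℕ) :
    ∑ i : Fin 6 × Fin 6, (if ((![0, 1, 1, 1, 1, 1] : Fin 6 → Fin 2) i.1, (![0, 1, 1, 1, 1, 1] : Fin 6 → Fin 2) i.2) = ((1 : Fin 2), (1 : Fin 2))
        then polar (U i.1) (U i.2) else 0) * (η i.1 + η i.2) ^ m
      = ∑ p : Fin 5, ∑ q : Fin 5, polar (U ((![1, 2, 3, 4, 5] : Fin 5 → Fin 6) p)) (U ((![1, 2, 3, 4, 5] : Fin 5 → Fin 6) q))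
          * (η ((![1, 2, 3, 4, 5] : Fin 5 → Fin 6) p) + η ((![1, 2, 3, 4, 5] : Fin 5 → Fin 6) q)) ^ m := by
  have h := sum_class_eq₅ (fun p q => polar (U p) (U q) * (η p + η q) ^ m) 1 1
  simp only [ite_mul, zero_mul] at h ⊢
  rw [h, weylQuint_fib, if_pos rfl]
  simp only [Fin.sum_univ_five, Matrix.cons_val_zero, Matrix.cons_val_one, Matrix.cons_val_two, Matrix.cons_val_three,
    Matrix.cons_val_four, Matrix.head_cons, Matrix.tail_cons]
  simp only [Finset.sum_insert (show (1 : Fin 6) ∉ ({2, 3, 4, 5} : Finset (Fin 6)) by decide),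
    Finset.sum_insert (show (2 : Fin 6) ∉ ({3, 4, 5} : Finset (Fin 6)) by decide),
    Finset.sum_insert (show (3 : Fin 6) ∉ ({4, 5} : Finset (Fin 6)) by decide),
    Finset.sum_insert (show (4 : Fin 6) ∉ ({5} : Finset (Fin 6)) by decide), Finset.sum_singleton]
  ring

/-- **Mixed class `(a,1)`** (`a ≠ 1`): a single letter against the quintuple. [this work] -/
theorem classMoment_mixed_left₅ (U : Fin 6 → Matrix (Fin 2) (Fin 2) ℝ) (η : Fin 6 → ℝ) (m : ℕ) (a : Fin 2) (ha : a ≠ 1) :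
    ∑ i : Fin 6 × Fin 6, (if ((![0, 1, 1, 1, 1, 1] : Fin 6 → Fin 2) i.1, (![0, 1, 1, 1, 1, 1] : Fin 6 → Fin 2) i.2) = (a, (1 : Fin 2))
        then polar (U i.1) (U i.2) else 0) * (η i.1 + η i.2) ^ m
      = ∑ q : Fin 5, polar (U a.castSucc.castSucc.castSucc.castSucc) (U ((![1, 2, 3, 4, 5] : Fin 5 → Fin 6) q))
          * (η a.castSucc.castSucc.castSucc.castSucc + η ((![1, 2, 3, 4, 5] : Fin 5 → Fin 6) q)) ^ m := by
  have h := sum_class_eq₅ (fun p q => polar (U p) (U q) * (η p + η q) ^ m) a 1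
  simp only [ite_mul, zero_mul] at h ⊢
  rw [h, weylQuint_fib, weylQuint_fib, if_neg ha, if_pos rfl, Finset.sum_singleton]
  simp only [Fin.sum_univ_five, Matrix.cons_val_zero, Matrix.cons_val_one, Matrix.cons_val_two, Matrix.cons_val_three,
    Matrix.cons_val_four, Matrix.head_cons, Matrix.tail_cons]
  rw [Finset.sum_insert (by decide), Finset.sum_insert (by decide), Finset.sum_insert (by decide), Finset.sum_insert (by decide),
    Finset.sum_singleton]
  ring

/-- **Mixed class `(1,a)`** (`a ≠ 1`). [this work] -/
theorem classMoment_mixed_right₅ (U : Fin 6 → Matrix (Fin 2) (Fin 2) ℝ) (η : Fin 6 → ℝ) (m : ℕ) (a : Fin 2) (ha : a ≠ 1) :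
    ∑ i : Fin 6 × Fin 6, (if ((![0, 1, 1, 1, 1, 1] : Fin 6 → Fin 2) i.1, (![0, 1, 1, 1, 1, 1] : Fin 6 → Fin 2) i.2) = ((1 : Fin 2), a)
        then polar (U i.1) (U i.2) else 0) * (η i.1 + η i.2) ^ m
      = ∑ p : Fin 5, polar (U ((![1, 2, 3, 4, 5] : Fin 5 → Fin 6) p)) (U a.castSucc.castSucc.castSucc.castSucc)
          * (η ((![1, 2, 3, 4, 5] : Fin 5 → Fin 6) p) + η a.castSucc.castSucc.castSucc.castSucc) ^ m := by
  have h := sum_class_eq₅ (fun p q => polar (U p) (U q) * (η p + η q) ^ m) 1 a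
  simp only [ite_mul, zero_mul] at h ⊢
  rw [h, weylQuint_fib, weylQuint_fib, if_neg ha, if_pos rfl]
  simp only [Finset.sum_singleton, Fin.sum_univ_five, Matrix.cons_val_zero, Matrix.cons_val_one, Matrix.cons_val_two,
    Matrix.cons_val_three, Matrix.cons_val_four, Matrix.head_cons, Matrix.tail_cons]
  rw [Finset.sum_insert (by decide), Finset.sum_insert (by decide), Finset.sum_insert (by decide), Finset.sum_insert (by decide),
    Finset.sum_singleton]
  ring

/-- **Pure class `(a,b)`** (`a, b ≠ 1`): a single member. [this work] -/
theorem classMoment_pure₅ (U : Fin 6 → Matrix (Fin 2) (Fin 2) ℝ) (η : Fin 6 → ℝ) (m : ℕ) (a b : Fin 2) (ha : a ≠ 1) (hb : b ≠ 1) :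
    ∑ i : Fin 6 × Fin 6, (if ((![0, 1, 1, 1, 1, 1] : Fin 6 → Fin 2) i.1, (![0, 1, 1, 1, 1, 1] : Fin 6 → Fin 2) i.2) = (a, b)
        then polar (U i.1) (U i.2) else 0) * (η i.1 + η i.2) ^ m
      = polar (U a.castSucc.castSucc.castSucc.castSucc) (U b.castSucc.castSucc.castSucc.castSucc)
          * (η a.castSucc.castSucc.castSucc.castSucc + η b.castSucc.castSucc.castSucc.castSucc) ^ m := by
  have h := sum_class_eq₅ (fun p q => polar (U p) (U q) * (η p + η q) ^ m) a b
  simp only [ite_mul, zero_mul] at h ⊢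
  rw [h, weylQuint_fib, weylQuint_fib, if_neg ha, if_neg hb, Finset.sum_singleton, Finset.sum_singleton]

/-- **Swapping a class preserves its moments** (`polar` is symmetric). [this work] -/
theorem classMoment_swap₅ (U : Fin 6 → Matrix (Fin 2) (Fin 2) ℝ) (η : Fin 6 → ℝ) (m : ℕ) (k : Fin 2 × Fin 2) :
    ∑ i : Fin 6 × Fin 6, (if ((![0, 1, 1, 1, 1, 1] : Fin 6 → Fin 2) i.1, (![0, 1, 1, 1, 1, 1] : Fin 6 → Fin 2) i.2) = k.swap
        then polar (U i.1) (U i.2) else 0) * (η i.1 + η i.2) ^ m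
      = ∑ i : Fin 6 × Fin 6, (if ((![0, 1, 1, 1, 1, 1] : Fin 6 → Fin 2) i.1, (![0, 1, 1, 1, 1, 1] : Fin 6 → Fin 2) i.2) = k
        then polar (U i.1) (U i.2) else 0) * (η i.1 + η i.2) ^ m := by
  rw [← Equiv.sum_comp (Equiv.prodComm (Fin 6) (Fin 6))]
  refine Finset.sum_congr rfl fun i _ => ?_
  simp only [Equiv.prodComm_apply, Prod.fst_swap, Prod.snd_swap]
  have hiff : (((![0, 1, 1, 1, 1, 1] : Fin 6 → Fin 2) i.2, (![0, 1, 1, 1, 1, 1] : Fin 6 → Fin 2) i.1) = k.swap)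
      ↔ (((![0, 1, 1, 1, 1, 1] : Fin 6 → Fin 2) i.1, (![0, 1, 1, 1, 1, 1] : Fin 6 → Fin 2) i.2) = k) := by
    constructor
    · intro h; have := congrArg Prod.swap h; simpa using this
    · intro h; rw [← h]; rfl
  rw [Bubbling.polar_comm (U i.2) (U i.1), add_comm (η i.2) (η i.1)]
  by_cases h : (((![0, 1, 1, 1, 1, 1] : Fin 6 → Fin 2) i.1, (![0, 1, 1, 1, 1, 1] : Fin 6 → Fin 2) i.2) = k)
  · rw [if_pos h, if_pos (hiff.mpr h)]
  · rw [if_neg h, if_neg (fun h' => h (hiff.mp h'))]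

/-- The deviations `η_l = δ_l − δ_{v l}` vanish at the value positions `0, 1`. [this work] -/
theorem weylQuint_eta_cast (δ : Fin 6 → ℝ) (a : Fin 2) :
    δ a.castSucc.castSucc.castSucc.castSucc
      - δ (((![0, 1, 1, 1, 1, 1] : Fin 6 → Fin 2) a.castSucc.castSucc.castSucc.castSucc).castSucc.castSucc.castSucc.castSucc) = 0 := by
  rw [weylQuint_v_cast, sub_self]

/-- **Symmetrisation (five letters)**: the 25 ordered members of the class `2α` of a quintuple have the moments of the FIFTEEN weighted members
`p ≤ q` (weight `1` on the diagonal, `2` off it) — the member count `K = 15` for #81 `momentTail`. [this work] -/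
theorem quintMoment_symmetrise (V : Fin 5 → Matrix (Fin 2) (Fin 2) ℝ) (x : Fin 5 → ℝ) (m : ℕ) :
    ∑ p, ∑ q, polar (V p) (V q) * (x p + x q) ^ m
      = ∑ pq ∈ (Finset.univ.filter fun pq : Fin 5 × Fin 5 => pq.1 ≤ pq.2),
          ((if pq.1 = pq.2 then 1 else 2) * polar (V pq.1) (V pq.2)) * (x pq.1 + x pq.2) ^ m := by
  have hset : (Finset.univ.filter fun pq : Fin 5 × Fin 5 => pq.1 ≤ pq.2)
      = {((0 : Fin 5), (0 : Fin 5)), (0, 1), (0, 2), (0, 3), (0, 4), (1, 1), (1, 2), (1, 3), (1, 4), (2, 2), (2, 3), (2, 4),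
          (3, 3), (3, 4), (4, 4)} := by decide
  rw [hset]
  simp only [Fin.sum_univ_five]
  rw [Finset.sum_insert (by decide), Finset.sum_insert (by decide), Finset.sum_insert (by decide),
    Finset.sum_insert (by decide), Finset.sum_insert (by decide), Finset.sum_insert (by decide),
    Finset.sum_insert (by decide), Finset.sum_insert (by decide), Finset.sum_insert (by decide),
    Finset.sum_insert (by decide), Finset.sum_insert (by decide), Finset.sum_insert (by decide),
    Finset.sum_insert (by decide), Finset.sum_insert (by decide), Finset.sum_singleton]
  have h01 : polar (V 1) (V 0) = polar (V 0) (V 1) := Bubbling.polar_comm _ _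
  have h02 : polar (V 2) (V 0) = polar (V 0) (V 2) := Bubbling.polar_comm _ _
  have h03 : polar (V 3) (V 0) = polar (V 0) (V 3) := Bubbling.polar_comm _ _
  have h04 : polar (V 4) (V 0) = polar (V 0) (V 4) := Bubbling.polar_comm _ _
  have h12 : polar (V 2) (V 1) = polar (V 1) (V 2) := Bubbling.polar_comm _ _
  have h13 : polar (V 3) (V 1) = polar (V 1) (V 3) := Bubbling.polar_comm _ _
  have h14 : polar (V 4) (V 1) = polar (V 1) (V 4) := Bubbling.polar_comm _ _
  have h23 : polar (V 3) (V 2) = polar (V 2) (V 3) := Bubbling.polar_comm _ _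
  have h24 : polar (V 4) (V 2) = polar (V 2) (V 4) := Bubbling.polar_comm _ _
  have h34 : polar (V 4) (V 3) = polar (V 3) (V 4) := Bubbling.polar_comm _ _
  simp only [h01, h02, h03, h04, h12, h13, h14, h23, h24, h34, Fin.isValue, if_true, show ((0 : Fin 5) = 1) = False by decide,
    show ((0 : Fin 5) = 2) = False by decide, show ((0 : Fin 5) = 3) = False by decide, show ((0 : Fin 5) = 4) = False by decide,
    show ((1 : Fin 5) = 2) = False by decide, show ((1 : Fin 5) = 3) = False by decide, show ((1 : Fin 5) = 4) = False by decide,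
    show ((2 : Fin 5) = 3) = False by decide, show ((2 : Fin 5) = 4) = False by decide, show ((3 : Fin 5) = 4) = False by decide,
    if_false]
  ring

end Summit.ValiantsHypothesis.ValiantsHypothesis.Theorems.LacunarySymmetroidMatrixDescartes.WallBubbling
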